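import Summits.AtomisticToContinuum.BoseEinsteinCondensation.Theses.BECInsertionCorrector
import Summits.AtomisticToContinuum.BoseEinsteinCondensation.Theorems.StaticResponseBound.Negative.Basic
import Literature.MathematicalPhysics.QuantumManyBody.WeightedCorrector
import Literature.MathematicalPhysics.QuantumManyBody.PeriodicBoseGasScatteringODE

/-!
# drefute gen-3 by-products for line `uv-thomson-force-wave` (crux `StaticResponseBound`,
# stmt-AtomisticToContinuum-12057): the kinetic half of the lead's sub-stub `stub_modulationRealForm`
# needs neither reality nor positivity of `Φ`

Mutation finding (drefute generation 3) on the registered sub-stub `stub_modulationRealForm` (S3 helper 1/5):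
its hypotheses `(∀ X, Φ.ψ X = ‖Φ.ψ X‖)` and `(∀ X, Φ.ψ X ≠ 0)` are NOT load-bearing for the kinetic term.
If a `C¹` wave function `ψ` is pointwise the complex cast of a real function `f` (`ψ X = (f X : ℂ)`), then `f = re ∘ ψ`
is itself `C¹` and the tree's kinetic density of `ψ` is `ENNReal.ofReal (gradDot f f X)` at every point — whatever
`f` is (here `f = θ·|Φ|`, differentiable or not a priori: differentiability is INHERITED from `ψ`).
-/

noncomputable section

namespace Summit.AtomisticToContinuum.BoseEinsteinCondensation.Theorems.StaticResponseBound.Negative.UvThomsonG3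

open MeasureTheory
open scoped ENNReal NNReal BigOperators
open Literature.MathematicalPhysics.QuantumManyBody.BoseGas

variable {N : ℕ}

/-- A complex function that is pointwise a real cast has real part equal to that real function. [folklore] -/
theorem re_comp_eq_of_eq_ofReal {ψ : Config N → ℂ} {f : Config N → ℝ} (h : ∀ X, ψ X = (f X : ℂ)) :
    (fun X => (ψ X).re) = f := by
  funext X
  rw [h X, Complex.ofReal_re]

/-- If `ψ = (f : ℂ)` pointwise and `ψ` is `C¹`, then `f` is `C¹` (as `f = re ∘ ψ`). [folklore] -/
theorem contDiff_of_eq_ofReal {ψ : Config N → ℂ} {f : Config N → ℝ} (hψ : ContDiff ℝ 1 ψ)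
    (h : ∀ X, ψ X = (f X : ℂ)) : ContDiff ℝ 1 f := by
  rw [← re_comp_eq_of_eq_ofReal h]
  exact Complex.reCLM.contDiff.comp hψ

/-- If `ψ = (f : ℂ)` pointwise with `f` differentiable at `X`, the Fréchet derivative of `ψ` at `X` is the
complex cast of that of `f`. [folklore] -/
theorem fderiv_apply_of_eq_ofReal {ψ : Config N → ℂ} {f : Config N → ℝ} (h : ∀ X, ψ X = (f X : ℂ))
    {X : Config N} (hf : DifferentiableAt ℝ f X) (e : Config N) :
    fderiv ℝ ψ X e = ((fderiv ℝ f X e : ℝ) : ℂ) := by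
  have hψ : ψ = fun Y => Complex.ofRealCLM (f Y) := by
    funext Y
    rw [h Y, Complex.ofRealCLM_apply]
  have hd : HasFDerivAt (fun Y => Complex.ofRealCLM (f Y)) (Complex.ofRealCLM.comp (fderiv ℝ f X)) X :=
    Complex.ofRealCLM.hasFDerivAt.comp X hf.hasFDerivAt
  rw [hψ, hd.fderiv]
  rfl

/-- `(‖a‖₊ : ℝ≥0∞)² = ENNReal.ofReal (a²)` for a real number. [folklore] -/
theorem coe_nnnorm_sq_real (a : ℝ) : ((‖a‖₊ : ℝ≥0∞)) ^ 2 = ENNReal.ofReal (a ^ 2) := by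
  rw [← ENNReal.coe_pow, ← sq_abs, ← Real.norm_eq_abs, ← coe_nnnorm, ← NNReal.coe_pow,
    ENNReal.ofReal_coe_nnreal]

/-- **Kinetic density of a real-cast wave function** (mutation lemma for `stub_modulationRealForm`): if
`ψ X = (f X : ℂ)` for all `X` and `ψ` is `C¹`, then `kineticDensity ψ X = ENNReal.ofReal (gradDot f f X)`
for every `X` — no positivity or reality hypothesis on any factor of `f` is needed. [folklore] -/
theorem kineticDensity_eq_ofReal_gradDot {ψ : Config N → ℂ} {f : Config N → ℝ} (hψ : ContDiff ℝ 1 ψ)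
    (h : ∀ X, ψ X = (f X : ℂ)) (X : Config N) :
    kineticDensity ψ X = ENNReal.ofReal (gradDot f f X) := by
  have hf : ContDiff ℝ 1 f := contDiff_of_eq_ofReal hψ h
  have hfX : DifferentiableAt ℝ f X := (hf.differentiable one_ne_zero) X
  unfold kineticDensity gradDot pderiv
  rw [ENNReal.ofReal_sum_of_nonneg (fun i _ => Finset.sum_nonneg fun k _ => mul_self_nonneg _)]
  refine Finset.sum_congr rfl fun i _ => ?_
  rw [ENNReal.ofReal_sum_of_nonneg (fun k _ => mul_self_nonneg _)]
  refine Finset.sum_congr rfl fun k _ => ?_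
  rw [fderiv_apply_of_eq_ofReal h hfX, Complex.nnnorm_real, coe_nnnorm_sq_real, sq]

/-- The same for the state of the sub-stub: `Ψ.ψ = θ·|Φ|` cast to `ℂ` gives
`kineticDensity Ψ.ψ X = ENNReal.ofReal (gradDot (θ·|Φ|) (θ·|Φ|) X)` with NO hypothesis on `Φ` or `θ`
beyond the pointwise identity (the `C¹` regularity comes from `Ψ`). [folklore] -/
theorem kineticDensity_modulated {L : ℝ} (Φ Ψ : PeriodicTrialState N L) (θ : Config N → ℝ)
    (hΨ : ∀ X, Ψ.ψ X = ((θ X * ‖Φ.ψ X‖ : ℝ) : ℂ)) (X : Config N) :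
    kineticDensity Ψ.ψ X =
      ENNReal.ofReal (gradDot (fun Y => θ Y * ‖Φ.ψ Y‖) (fun Y => θ Y * ‖Φ.ψ Y‖) X) :=
  kineticDensity_eq_ofReal_gradDot Ψ.contDiff hΨ X

end Summit.AtomisticToContinuum.BoseEinsteinCondensation.Theorems.StaticResponseBound.Negative.UvThomsonG3

end
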